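import Summits.QuantumFields.GaugeBoot.TiltedBoxAxisRPNegative
import Summits.QuantumFields.GaugeBoot.DiagonalRPTorusNontrivialRep
import HarnessLib

/-!
# Axis reflection positivity along `i` fails on the tilted box EVEN ON THE GAUGE-INVARIANT SECTOR, `d ≥ 3` (gauge-boot, L3 negative supplement, part 3)

HONEST FRAMING (cell `pub-gaugeboot`, page 1 of every file): the venture produces certified bounds
on lattice expectations at stated coupling, gauge group, dimension and torus size; NOT a mass gap,
NOT a continuum limit, NOT a string tension; NOT Yang–Mills-summit-bearing (barriers
`FixedCouplingUltralocality`, `PerturbativeInvisibility`). This module is a small NEGATIVE result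
about which positivity blocks a certificate on the tilted box may use; it discharges nothing else.

`TiltedBoxAxisRPNegative.lean` refutes closed-half reflection positivity along the in-plane axis `i`
of the square tilted box of even side `M_u = M_v = 2P` with a TWO-LINK witness that is not gauge
invariant (tribunal t1 v2.5 A16 caveat (b)). What an SDP loop block needs is the GAUGE-INVARIANT
sector: every bootstrap positivity block is a Gram matrix of Wilson loops. This file lands the
tribunals' pointer P-R2 (t2 add4 §0.2(b); t1 v2.5 A22) as a theorem, for `d ≥ 3`:

* `gaugeAct e g U` — gauge transformations `U(x, k) ↦ g(x) U(x, k) g(x + e_k)⁻¹` of a periodic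
  lattice; `holonomy_gaugeAct` (plaquette holonomies are conjugated); `IsGaugeInvariantObs`.
* On the layer `x_i ≡ P` the flip `Θ_i` acts as the TRANSLATION by `[2P e_j]`
  (`tiltedAxisFlip_layerSite = layerSite + 2P • e_j`, as `[−2P e_i] = [2P e_j]`:
  `2P(e_i + e_j) ∈ Γ`), of order two and WITHOUT fixed points (`2P e_j ∉ Γ`).
* **`tiltedBox_axisRP_neg_gaugeInvariant`** — for an axis `k ∉ {i, j}` (so `d ≥ 3`), the observable
  `F(U) = Re tr ρ(U_{p}) − Re tr ρ(U_{Θ_i p})`, `p` the `(j, k)`-plaquette based at the layer site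
  `[P e_i]`, is a difference of two Wilson loops (GAUGE INVARIANT, `isGaugeInvariantObs_witness`), an
  observable of the closed half `{0 ≤ x_i ≤ P (mod 2P)}` (all eight links lie in the layer), ODD under
  `Θ_i` (the `j`-, `k`-links are carried along and `Θ_i² = 1`), continuous, and non-zero on an open set
  as soon as `ρ` is non-trivial (`∃ g, ρ g ≠ 1`: set one `k`-link of `p` to `g`, everything else to `1`);
  hence `∫ conj F(Θ_i U) · F(U) dμ_β = −∫ F² dμ_β < 0` at EVERY real `β` (`integral_sq_gibbs_pos`).
* **`not_tiltedBox_axisRP_gaugeInvariant`** — closed-half reflection positivity along `i` in the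
  shape of `tiltedBox_siteRP`, RESTRICTED to gauge-invariant half observables, is FALSE on the square
  tilted box of even side, `d ≥ 3`, every real `β`, every compact second countable `G` with a
  non-trivial continuous `ρ`. So the numerics guard "flips along `i`, `j` enter a tilted-box SDP only
  as identifications, never as PSD blocks" is NECESSARY, not merely conservative (t1 A12/A16). `d = 2`
  stays open (the layer is a line of `j`-links whose closed loops are `2P e_j`-periodic windings).

References: J. Fröhlich, R. Israel, E. H. Lieb, B. Simon, J. Stat. Phys. 22 (1980) 297, §3 (Model
3.1); K. Osterwalder, E. Seiler, Ann. Phys. 110 (1978) 440, Thm. 2.1 (RP for gauge-invariant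
half-space functions); V. Kazakov, Z. Zheng, arXiv:2203.11360 §3.1 (positivity blocks are Gram
matrices of Wilson lines).
-/

noncomputable section

open MeasureTheory Complex QuotientAddGroup
open scoped ComplexOrder ComplexConjugate
open Literature.RepresentationTheory.CompactGroups

namespace Summit.QuantumFields.GaugeBoot

namespace TiltedRP

/-! ## Gauge transformations of a periodic lattice -/

section Gauge

variable {A : Type*} [AddCommGroup A] {d N : ℕ} {G : Type*} [Group G]

/-- **Gauge transformation** of a configuration of the periodic lattice `(A, e)` by `g : A → G`:
`U(x, k) ↦ g(x) U(x, k) g(x + e_k)⁻¹`. [folklore] -/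
def gaugeAct (e : Fin d → A) (g : A → G) (U : Config A d G) : Config A d G :=
  fun l => g l.1 * U l * (g (l.1 + e l.2))⁻¹

/-- `gaugeAct` evaluated. [folklore] -/
@[simp] theorem gaugeAct_apply (e : Fin d → A) (g : A → G) (U : Config A d G) (l : Link A d) :
    gaugeAct e g U l = g l.1 * U l * (g (l.1 + e l.2))⁻¹ := rfl

/-- **Plaquette holonomies transform by conjugation**: `(U^g)_{x;k,l} = g(x) U_{x;k,l} g(x)⁻¹`.
[folklore] -/
theorem holonomy_gaugeAct (e : Fin d → A) (g : A → G) (U : Config A d G) (x : A) (k l : Fin d) :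
    holonomy e (gaugeAct e g U) x k l = g x * holonomy e U x k l * (g x)⁻¹ := by
  simp only [holonomy, gaugeAct_apply, add_right_comm x (e l) (e k), mul_inv_rev, inv_inv]
  group

/-- A GAUGE-INVARIANT observable of the periodic lattice. [shape] A parametric predicate — NOT a
named fact. [folklore] -/
def IsGaugeInvariantObs {α : Type*} (e : Fin d → A) (F : Config A d G → α) : Prop :=
  ∀ (g : A → G) (U : Config A d G), F (gaugeAct e g U) = F U

variable (ρ : G →* Matrix (Fin N) (Fin N) ℂ)

/-- The trace of a plaquette holonomy is gauge invariant. [folklore] -/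
theorem trace_holonomy_gaugeAct (e : Fin d → A) (g : A → G) (U : Config A d G) (x : A) (k l : Fin d) :
    (ρ (holonomy e (gaugeAct e g U) x k l)).trace = (ρ (holonomy e U x k l)).trace := by
  rw [holonomy_gaugeAct, CompactGroup.trace_conj_eq]

end Gauge

/-! ## The flip along `i` translates the layer `x_i ≡ P` by `[2P e_j]` -/

section Layer

variable (d : ℕ) {i j : Fin d} (L P : ℕ)

/-- The coordinate `x_i mod 2P` is unchanged along every axis `l ≠ i`. [folklore] -/
theorem tiltedAxisCoord_add_unit_of_ne {l : Fin d} (hl : l ≠ i)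
    (q : TiltedSite d i j (2 * P) (2 * P) L) :
    tiltedAxisCoord d L P (q + tiltedUnit d i j (2 * P) (2 * P) L l) = tiltedAxisCoord d L P q := by
  rw [map_add]
  have h0 : tiltedAxisCoord d L P (tiltedUnit d i j (2 * P) (2 * P) L l) = 0 := by
    show tiltedAxisCoord d L P ((Pi.single l (1 : ℤ) : Fin d → ℤ) : TiltedSite d i j (2 * P) (2 * P) L)
      = 0
    rw [tiltedAxisCoord_mk, Pi.single_eq_of_ne (Ne.symm hl), Int.cast_zero]
  rw [h0, add_zero]

/-- **On the layer site the flip is the translation by `2P e_j`**: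
`Θ_i [P e_i] = [−P e_i] = [P e_i] + 2P • e_j` (because `2P (e_i + e_j) ∈ Γ`). [folklore] -/
theorem tiltedAxisFlip_layerSite (hij : i ≠ j) :
    tiltedAxisFlip d L (2 * P) hij (layerSite d L P) =
      (layerSite d L P : TiltedSite d i j _ _ L) + ((2 * P : ℕ) : ℤ) • tiltedUnit d i j (2 * P) (2 * P) L j := by
  have hsum := tiltedUnit_inPlane_sum_eq_zero d (2 * P) (2 * P) L hij
  -- `[P e_i] = P • e_i`
  have hx : (layerSite d L P : TiltedSite d i j (2 * P) (2 * P) L) =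
      (P : ℤ) • tiltedUnit d i j (2 * P) (2 * P) L i := by
    show QuotientAddGroup.mk' (tiltedLattice d i j (2 * P) (2 * P) L) (Pi.single i (P : ℤ)) = _
    rw [show (Pi.single i (P : ℤ) : Fin d → ℤ) = (P : ℤ) • (Pi.single i (1 : ℤ) : Fin d → ℤ) by
      rw [← Pi.single_smul', smul_eq_mul, mul_one], map_zsmul]
    rfl
  rw [hx, map_zsmul, (isAxisFlip_tiltedAxisFlip d L (2 * P) hij).map_e_self, zsmul_neg,
    neg_eq_iff_add_eq_zero, ← add_assoc, ← add_zsmul,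
    show ((P : ℤ) + P) = ((2 * P : ℕ) : ℤ) by push_cast; ring, hsum]

end Layer

/-! ## The gauge-invariant witness -/

section Witness

variable {d : ℕ} {i j k : Fin d} {P L N : ℕ} {G : Type*} [Group G] (ρ : G →* Matrix (Fin N) (Fin N) ℂ)

/-- The `(j, k)`-plaquette trace `Re tr ρ(U_{q; j, k})` at a site `q` of the square box. [folklore] -/
def plaqRe (q : TiltedSite d i j (2 * P) (2 * P) L) (j' k' : Fin d)
    (U : Config (TiltedSite d i j (2 * P) (2 * P) L) d G) : ℝ :=
  ((ρ (holonomy (tiltedUnit d i j (2 * P) (2 * P) L) U q j' k')).trace).re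

/-- `plaqRe` is gauge invariant. [folklore] -/
theorem plaqRe_gaugeAct (q : TiltedSite d i j (2 * P) (2 * P) L) (j' k' : Fin d)
    (g : TiltedSite d i j (2 * P) (2 * P) L → G) (U : Config (TiltedSite d i j (2 * P) (2 * P) L) d G) :
    plaqRe ρ q j' k' (gaugeAct (tiltedUnit d i j (2 * P) (2 * P) L) g U) = plaqRe ρ q j' k' U := by
  rw [plaqRe, plaqRe, trace_holonomy_gaugeAct]

/-- `plaqRe` is continuous in the configuration (continuous `ρ`). [folklore] -/
theorem continuous_plaqRe [TopologicalSpace G] [IsTopologicalGroup G] (hρ : Continuous ρ) (q : TiltedSite d i j (2 * P) (2 * P) L) (j' k' : Fin d) :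
    Continuous (plaqRe (G := G) ρ q j' k') :=
  Complex.continuous_re.comp ((hρ.comp (continuous_holonomy _ q j' k')).matrix_trace)

/-- Under the flip along `i`, a `(j, k)`-plaquette trace (`j, k ≠ i`) is read at the flipped site:
the `j`- and `k`-links are carried along. [folklore] -/
theorem plaqRe_configReflect (hij : i ≠ j) (hki : k ≠ i) (q : TiltedSite d i j (2 * P) (2 * P) L)
    (U : Config (TiltedSite d i j (2 * P) (2 * P) L) d G) :
    plaqRe ρ q j k (configReflect (tiltedUnit d i j (2 * P) (2 * P) L) i (tiltedAxisFlip d L (2 * P) hij) U)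
      = plaqRe ρ (tiltedAxisFlip d L (2 * P) hij q) j k U := by
  have hF := isAxisFlip_tiltedAxisFlip d L (2 * P) hij
  simp only [plaqRe, holonomy, configReflect_other _ i _ U _ hij.symm, configReflect_other _ i _ U _ hki,
    hF.map_add_other _ hij.symm, hF.map_add_other _ hki]

/-- **The gauge-invariant witness**: `F(U) = Re tr ρ(U_p) − Re tr ρ(U_{Θ_i p})`, `p` the
`(j, k)`-plaquette at the layer site `[P e_i]`. [folklore] -/
def axisWitness (hij : i ≠ j) (k : Fin d) (U : Config (TiltedSite d i j (2 * P) (2 * P) L) d G) : ℝ :=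
  plaqRe ρ (layerSite d L P) j k U - plaqRe ρ (tiltedAxisFlip d L (2 * P) hij (layerSite d L P)) j k U

/-- The witness is gauge invariant. [folklore] -/
theorem isGaugeInvariantObs_witness (hij : i ≠ j) :
    IsGaugeInvariantObs (tiltedUnit d i j (2 * P) (2 * P) L) (axisWitness (P := P) (L := L) (G := G) ρ hij k) := by
  intro g U
  simp only [axisWitness, plaqRe_gaugeAct]

/-- The witness is odd under the flip (`Θ_i² = 1`). [folklore] -/
theorem axisWitness_configReflect (hij : i ≠ j) (hki : k ≠ i)
    (U : Config (TiltedSite d i j (2 * P) (2 * P) L) d G) :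
    axisWitness ρ hij k (configReflect (tiltedUnit d i j (2 * P) (2 * P) L) i
        (tiltedAxisFlip d L (2 * P) hij) U) = -axisWitness ρ hij k U := by
  simp only [axisWitness, plaqRe_configReflect ρ hij hki, (isAxisFlip_tiltedAxisFlip d L (2 * P) hij).invol]
  ring

/-- The witness is an observable of the closed half `{0 ≤ x_i ≤ P (mod 2P)}`: it depends only on the
eight links of the two plaquettes, all of which lie in the layer `x_i ≡ P`. [folklore] -/
theorem isHalfObservable_witness [NeZero P] (hij : i ≠ j) (hki : k ≠ i) :
    IsHalfObservable (tiltedUnit d i j (2 * P) (2 * P) L) P (tiltedAxisCoord d L P)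
      (axisWitness (G := G) ρ hij k) := by
  have hP : 0 < P := Nat.pos_of_ne_zero (NeZero.ne P)
  have hval : ((P : ZMod (2 * P))).val = P := by
    rw [ZMod.val_natCast]; exact Nat.mod_eq_of_lt (by omega)
  -- every site of the form `q`, `q + e_j`, `q + e_k` with `coord q = P` is in the closed half
  have hin : ∀ q : TiltedSite d i j (2 * P) (2 * P) L, tiltedAxisCoord d L P q = (P : ZMod (2 * P)) →
      ∀ l : Fin d, l ≠ i → IsHalfLink (tiltedUnit d i j (2 * P) (2 * P) L) P (tiltedAxisCoord d L P) (q, l) ∧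
        ∀ l' : Fin d, l' ≠ i →
          IsHalfLink (tiltedUnit d i j (2 * P) (2 * P) L) P (tiltedAxisCoord d L P)
            (q + tiltedUnit d i j (2 * P) (2 * P) L l', l) := by
    intro q hq l hl
    refine ⟨⟨?_, ?_⟩, fun l' hl' => ⟨?_, ?_⟩⟩
    · show (tiltedAxisCoord d L P q).val ≤ P
      rw [hq, hval]
    · show (tiltedAxisCoord d L P (q + tiltedUnit d i j (2 * P) (2 * P) L l)).val ≤ P
      rw [tiltedAxisCoord_add_unit_of_ne d L P hl, hq, hval]
    · show (tiltedAxisCoord d L P (q + tiltedUnit d i j (2 * P) (2 * P) L l')).val ≤ P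
      rw [tiltedAxisCoord_add_unit_of_ne d L P hl', hq, hval]
    · show (tiltedAxisCoord d L P (q + tiltedUnit d i j (2 * P) (2 * P) L l' +
        tiltedUnit d i j (2 * P) (2 * P) L l)).val ≤ P
      rw [tiltedAxisCoord_add_unit_of_ne d L P hl, tiltedAxisCoord_add_unit_of_ne d L P hl', hq, hval]
  have h0 : tiltedAxisCoord d L P (layerSite d L P : TiltedSite d i j _ _ L) = (P : ZMod (2 * P)) :=
    tiltedAxisCoord_layerSite d L P
  have h1 : tiltedAxisCoord d L P (tiltedAxisFlip d L (2 * P) hij (layerSite d L P)) =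
      (P : ZMod (2 * P)) := by
    rw [tiltedAxisCoord_tiltedAxisFlip, h0, neg_natCast_self]
  intro U V hUV
  have hplaq : ∀ q : TiltedSite d i j (2 * P) (2 * P) L, tiltedAxisCoord d L P q = (P : ZMod (2 * P)) →
      plaqRe ρ q j k U = plaqRe ρ q j k V := by
    intro q hq
    obtain ⟨hj, hj'⟩ := hin q hq j hij.symm
    obtain ⟨hk, hk'⟩ := hin q hq k hki
    simp only [plaqRe]
    rw [holonomy_congr _ q j k (hUV _ hj) (hUV _ (hk' j hij.symm)) (hUV _ (hj' k hki)) (hUV _ hk)]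
  simp only [axisWitness, hplaq _ h0, hplaq _ h1]

/-- The `k`-link `([P e_i] + e_j, k)` of the first plaquette is not a link of the second one and not
its other `k`-link. [folklore] -/
theorem witnessLink_ne [NeZero P] (hij : i ≠ j) :
    ((layerSite d L P : TiltedSite d i j (2 * P) (2 * P) L) + tiltedUnit d i j (2 * P) (2 * P) L j, k) ≠
        ((layerSite d L P : TiltedSite d i j (2 * P) (2 * P) L), k) ∧
      ((layerSite d L P : TiltedSite d i j (2 * P) (2 * P) L) + tiltedUnit d i j (2 * P) (2 * P) L j, k) ≠
        (tiltedAxisFlip d L (2 * P) hij (layerSite d L P) + tiltedUnit d i j (2 * P) (2 * P) L j, k) ∧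
      ((layerSite d L P : TiltedSite d i j (2 * P) (2 * P) L) + tiltedUnit d i j (2 * P) (2 * P) L j, k) ≠
        (tiltedAxisFlip d L (2 * P) hij (layerSite d L P), k) := by
  have hP : 0 < P := Nat.pos_of_ne_zero (NeZero.ne P)
  -- `m • e_j = 0` in the box forces `4P ∣ m` (first congruence: `x_i + x_j = m`)
  have hsmul : ∀ m : ℤ, m • tiltedUnit d i j (2 * P) (2 * P) L j = 0 → ((2 * (2 * P) : ℕ) : ℤ) ∣ m := by
    intro m hm
    have hmk : ((m • (Pi.single j (1 : ℤ) : Fin d → ℤ) : Fin d → ℤ) : TiltedSite d i j (2 * P) (2 * P) L) =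
        m • tiltedUnit d i j (2 * P) (2 * P) L j := by
      show QuotientAddGroup.mk' (tiltedLattice d i j (2 * P) (2 * P) L) (m • (Pi.single j (1 : ℤ) : Fin d → ℤ))
        = _
      rw [map_zsmul]
      rfl
    rw [← hmk, QuotientAddGroup.eq_zero_iff, mem_tiltedLattice_iff] at hm
    obtain ⟨h1, -, -⟩ := hm
    simpa [Pi.single_eq_of_ne hij] using h1
  refine ⟨fun h => ?_, fun h => ?_, fun h => ?_⟩
  · -- `e_j = 0`
    have h' : (1 : ℤ) • tiltedUnit d i j (2 * P) (2 * P) L j = 0 := by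
      rw [one_zsmul]; exact add_eq_left.1 (Prod.ext_iff.1 h).1
    have := Int.le_of_dvd one_pos (hsmul 1 h')
    push_cast at this; omega
  · -- `2P e_j = 0`
    have h' := (Prod.ext_iff.1 h).1
    rw [tiltedAxisFlip_layerSite, add_right_comm, left_eq_add] at h'
    have := Int.le_of_dvd (by positivity) (hsmul _ h')
    push_cast at this; omega
  · -- `(1 - 2P) e_j = 0`, from `e_j = 2P e_j`
    have h' := (Prod.ext_iff.1 h).1
    rw [tiltedAxisFlip_layerSite, add_right_inj] at h'
    have h'' : ((1 : ℤ) - ((2 * P : ℕ) : ℤ)) • tiltedUnit d i j (2 * P) (2 * P) L j = 0 := by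
      rw [sub_zsmul, one_zsmul, ← h']
      abel
    have hd := hsmul _ h''
    have h2 : ((2 * (2 * P) : ℕ) : ℤ) ∣ ((1 : ℤ) - ((2 * P : ℕ) : ℤ)) + ((2 * (2 * P) : ℕ) : ℤ) :=
      dvd_add hd (dvd_refl _)
    have := Int.le_of_dvd (by push_cast; omega) h2
    push_cast at this; omega

/-- **The witness does not vanish identically**: with one `k`-link of the first plaquette set to
`g` and all other links to `1`, `F = Re tr ρ(g) − N`. [folklore] -/
theorem axisWitness_update_one [NeZero P] [DecidableEq (TiltedSite d i j (2 * P) (2 * P) L)]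
    (hij : i ≠ j) (hkj : k ≠ j) (g : G) :
    axisWitness ρ hij k (Function.update (fun _ => (1 : G))
        ((layerSite d L P : TiltedSite d i j (2 * P) (2 * P) L) + tiltedUnit d i j (2 * P) (2 * P) L j, k) g)
      = ((ρ g).trace).re - N := by
  obtain ⟨h1, h2, h3⟩ := witnessLink_ne (d := d) (k := k) (P := P) (L := L) hij
  have hjk : ∀ (q q' : TiltedSite d i j (2 * P) (2 * P) L),
      ((q, j) : Link (TiltedSite d i j (2 * P) (2 * P) L) d) ≠ (q', k) :=
    fun q q' h => hkj (Prod.ext_iff.1 h).2.symm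
  simp only [axisWitness, plaqRe, holonomy, Function.update_self, Function.update_of_ne (hjk _ _),
    Function.update_of_ne h1.symm, Function.update_of_ne h2.symm, Function.update_of_ne h3.symm, one_mul,
    mul_one, inv_one, map_one, Matrix.trace_one, Fintype.card_fin, Complex.natCast_re]

end Witness

section Main

variable {d : ℕ} {i j k : Fin d} {P L N : ℕ} [NeZero P] [NeZero L]
variable {G : Type*} [Group G] [TopologicalSpace G] [IsTopologicalGroup G] [CompactSpace G]
  [MeasurableSpace G] [BorelSpace G] [SecondCountableTopology G]
variable (ρ : G →* Matrix (Fin N) (Fin N) ℂ)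

/-- **P-R2: axis reflection positivity along `i` fails on the square tilted box of even side ON THE
GAUGE-INVARIANT SECTOR, `d ≥ 3`, at every coupling.** Box `ℤ^d / Γ(2P, 2P, L)` (`P ≥ 1`, `L ≥ 1`,
`i ≠ j`, an axis `k ∉ {i, j}`), `Θ_i` the flip along `i`, closed half `{0 ≤ x_i ≤ P (mod 2P)}`; `G`
compact second countable (no Hausdorff hypothesis: the witness is a
character, not an Urysohn function), `ρ` continuous and NON-TRIVIAL (`∃ g, ρ g ≠ 1`), `β ∈ ℝ` arbitrary.
There is a measurable bounded GAUGE-INVARIANT observable `F` of the closed half (a difference of two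
plaquette traces in the layer `x_i ≡ P`), odd under `Θ_i`, with `∫ conj F(Θ_i U) · F(U) dμ_β < 0`.
[small new negative; mechanism folklore: FILS80 §3 Model 3.1, Biskup09 §5.5] -/
theorem tiltedBox_axisRP_neg_gaugeInvariant (hij : i ≠ j) (hki : k ≠ i) (hkj : k ≠ j)
    (hρ : Continuous ρ) (hρ1 : ∃ g, ρ g ≠ 1) (β : ℝ) :
    ∃ F : Config (TiltedSite d i j (2 * P) (2 * P) L) d G → ℂ, Measurable F ∧ (∃ C : ℝ, ∀ U, ‖F U‖ ≤ C) ∧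
      IsHalfObservable (tiltedUnit d i j (2 * P) (2 * P) L) P (tiltedAxisCoord d L P) F ∧
      IsGaugeInvariantObs (tiltedUnit d i j (2 * P) (2 * P) L) F ∧
      (∀ U, F (configReflect (tiltedUnit d i j (2 * P) (2 * P) L) i (tiltedAxisFlip d L (2 * P) hij) U)
        = -F U) ∧
      ∫ U, conj (F (configReflect (tiltedUnit d i j (2 * P) (2 * P) L) i
          (tiltedAxisFlip d L (2 * P) hij) U)) * F U ∂(gibbs ρ (tiltedUnit d i j (2 * P) (2 * P) L) β)
        < 0 := by
  classical
  set h : Config (TiltedSite d i j (2 * P) (2 * P) L) d G → ℝ := axisWitness ρ hij k with hh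
  have hcont : Continuous h :=
    (continuous_plaqRe ρ hρ _ j k).sub (continuous_plaqRe ρ hρ _ j k)
  have hmeas : Measurable h := hcont.measurable
  -- bound `|h| ≤ 2N`
  have hbound : ∀ U, |h U| ≤ N + N := fun U => by
    have h1 : |plaqRe ρ (layerSite d L P) j k U| ≤ N := by
      simpa [plaqRe] using CompactGroup.abs_re_trace_le_card ρ hρ
        (holonomy (tiltedUnit d i j (2 * P) (2 * P) L) U (layerSite d L P) j k)
    have h2 : |plaqRe ρ (tiltedAxisFlip d L (2 * P) hij (layerSite d L P)) j k U| ≤ N := by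
      simpa [plaqRe] using CompactGroup.abs_re_trace_le_card ρ hρ
        (holonomy (tiltedUnit d i j (2 * P) (2 * P) L) U (tiltedAxisFlip d L (2 * P) hij (layerSite d L P)) j k)
    exact (abs_sub _ _).trans (add_le_add h1 h2)
  have hodd : ∀ U, h (configReflect (tiltedUnit d i j (2 * P) (2 * P) L) i (tiltedAxisFlip d L (2 * P) hij) U)
      = -h U := fun U => axisWitness_configReflect ρ hij hki U
  -- non-vanishing on an open set
  obtain ⟨g, hg⟩ := (DiagRPTwo.exists_re_trace_ne_iff ρ hρ).2 hρ1
  set O : Set (Config (TiltedSite d i j (2 * P) (2 * P) L) d G) := h ⁻¹' {t | t ≠ 0} with hOdef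
  have hO : IsOpen O := isOpen_ne.preimage hcont
  have hOne : O.Nonempty := by
    refine ⟨Function.update (fun _ => (1 : G))
      ((layerSite d L P : TiltedSite d i j (2 * P) (2 * P) L) + tiltedUnit d i j (2 * P) (2 * P) L j, k) g, ?_⟩
    show h _ ≠ 0
    rw [hh, axisWitness_update_one ρ hij hkj g]
    exact sub_ne_zero.2 hg
  have hOh : ∀ U ∈ O, h U ≠ 0 := fun U hU => hU
  refine ⟨fun U => (h U : ℂ), Complex.measurable_ofReal.comp hmeas, ⟨N + N, fun U => ?_⟩, ?_, ?_,
    fun U => ?_, ?_⟩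
  · rw [Complex.norm_real, Real.norm_eq_abs]; exact hbound U
  · intro U V hUV
    simp only [hh, isHalfObservable_witness ρ hij hki U V hUV]
  · intro g' U
    simp only [hh, isGaugeInvariantObs_witness ρ hij g' U]
  · show ((h _ : ℝ) : ℂ) = -((h U : ℝ) : ℂ)
    rw [hodd]; push_cast; ring
  · have hint : (fun U => conj ((h (configReflect (tiltedUnit d i j (2 * P) (2 * P) L) i
        (tiltedAxisFlip d L (2 * P) hij) U) : ℝ) : ℂ) * (h U : ℂ)) = fun U => ((-(h U ^ 2) : ℝ) : ℂ) := by
      funext U; rw [Complex.conj_ofReal, hodd]; push_cast; ring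
    rw [hint, integral_complex_ofReal, ← Complex.ofReal_zero, Complex.real_lt_real, integral_neg, neg_lt_zero]
    exact integral_sq_gibbs_pos ρ hρ _ β hmeas hbound hO hOne hOh

/-- **Corollary: on the square tilted box of even side (`d ≥ 3`) closed-half axis reflection
positivity along `i` is FALSE even when restricted to GAUGE-INVARIANT half observables** (every real
`β`, every compact second countable `G`, every non-trivial continuous `ρ`). Hence no PSD block
along `i` (or `j`) built from Wilson loops exists for a tilted-box certificate: the guard "in-plane flips
are identifications only" is necessary. [small new negative; mechanism folklore: FILS80 §3, Biskup09 §5.5] -/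
theorem not_tiltedBox_axisRP_gaugeInvariant (hij : i ≠ j) (hki : k ≠ i) (hkj : k ≠ j)
    (hρ : Continuous ρ) (hρ1 : ∃ g, ρ g ≠ 1) (β : ℝ) :
    ¬ ∀ F : Config (TiltedSite d i j (2 * P) (2 * P) L) d G → ℂ, Measurable F →
        (∃ C : ℝ, ∀ U, ‖F U‖ ≤ C) →
        IsHalfObservable (tiltedUnit d i j (2 * P) (2 * P) L) P (tiltedAxisCoord d L P) F →
        IsGaugeInvariantObs (tiltedUnit d i j (2 * P) (2 * P) L) F →
        0 ≤ ∫ U, conj (F (configReflect (tiltedUnit d i j (2 * P) (2 * P) L) i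
          (tiltedAxisFlip d L (2 * P) hij) U)) * F U ∂(gibbs ρ (tiltedUnit d i j (2 * P) (2 * P) L) β) := by
  intro hRP
  obtain ⟨F, hFm, hFb, hFo, hFg, -, hneg⟩ :=
    tiltedBox_axisRP_neg_gaugeInvariant (P := P) (L := L) ρ hij hki hkj hρ hρ1 β
  exact lt_irrefl _ (lt_of_le_of_lt (hRP F hFm hFb hFo hFg) hneg)

end Main

end TiltedRP

end Summit.QuantumFields.GaugeBoot
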